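import Mathlib
import HarnessLib

/-!
# Conrey–Iwaniec–Soundararajan, *Asymptotic Large Sieve* (arXiv:1105.1176), §2 "General Results":
# Proposition 2.1, Theorem 2.2, Theorem 2.4

Topic `Literature/NumberTheory/LFunctions` (namespace `Literature.NumberTheory.LFunctions`; the
paper's objects live in the sub-namespace `AsymptoticLargeSieve`). STATEMENT LAYER (D-0014): three
NAMED FACTS (`def … : Prop`, nothing asserted; STATUS: preprint CLAIMS — arXiv:1105.1176 (2011) has no journal
version (zbMATH/arXiv check 2026-08-26), so each fact is tagged [claim: ConreyIwaniecSoundararajan2011ALS, status: under-review];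
the results are used in print by Conrey–Iwaniec–Soundararajan, Crelle 2013 — tree `CriticalZerosDirichletFamily.lean`) — Proposition 2.1 (the
diagonal), Theorem 2.2 (general coefficients, length `N ≤ Q^{1−ε}`), Theorem 2.4 (mollifier-shaped
coefficients for `ζ`, length `N ≤ Q^{2−δ}`, mollifier length `X ≤ Q^{1−ε}`) — over honest
definitions of the paper's bilinear form `𝒮(𝒜×ℬ)`, its diagonal `𝒮_diag`, the family average
`Δ(m,n)` over primitive Dirichlet characters of conductor `q ≍ Q`, the local factor `δ(m)` and the
singular series `𝔖`, all in Mathlib's vocabulary (`DirichletCharacter`, `IsPrimitive`,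
`Nat.totient`, `ArithmeticFunction.sigma 0` = `τ`). Typed for the Landau–Siegel programme
(rung F-S3, §C harvest / §B-len START-HERE): this is the printed off-diagonal input that lets a
Dirichlet polynomial of length up to `Q^{2−δ}` (i.e. a mollifier of length `q^{θ}`, `θ < 1`, against
an approximate functional equation of length `q`) be evaluated asymptotically ON AVERAGE over the
conductor — the "support `< 2`" edge of ESTAR row E*-len. Nothing here is a claim about a single
modulus, about exceptional characters, or about any manuscript.

## What the source prints (held text `paper:arxiv-1105.1176`, corpus-tex chunks p0005–p0008,
## p0016–p0019, read 2026-08-26; equation (2.k) is printed "(2k)" by the extractor)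

J. B. Conrey, H. Iwaniec, K. Soundararajan, *Asymptotic Large Sieve*, arXiv:1105.1176 (2011)
[ConreyIwaniecSoundararajan2011ALS].

**§2, standing data** (p0005:L12–p0006). "Our objective is to evaluate asymptotically the bilinear form
`𝒮(𝒜×ℬ) = Σ_q Ψ(q/Q)/φ(q) Σ*_{χ (mod q)} Σ_m Σ_n a_m b_n F(m,n) χ(m) χ̄(n)` (2.1)
for two sequences `𝒜 = (a_m)`, `ℬ = (b_n)` of complex numbers … Here the conductor `q` is restricted
by a smooth function `Ψ` of compact support in `ℝ⁺`, so `q ≍ Q`, and `Q` is a large parameter."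
"The function `F(x,y)` is assumed to be smooth and supported in a square box `1 ≤ x, y ≤ N`,
`N ≥ 2` (2.2). We assume that `x^i y^j |F^{(i,j)}(x,y)| ≤ 1` if `0 ≤ i, j ≤ 2` (2.3)."
"We assume `|a_m| ≤ m^{−1/2} τ(m)^A`, `|b_n| ≤ n^{−1/2} τ(n)^A` (2.4)." "In applications our
coefficients appear as the convolution `a_m = m^{−1/2} Σ_{lr=m} λ(l) ρ(r)` (2.5) with `λ(l)` being
the coefficients of an `L`-function `𝓛(s) = Σ_l λ(l) l^{−s}` (2.6) and `ρ(r)` being the coefficients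
of `𝓛(s)^{−1}` modified by smooth weights supported on `1 ≤ r ≤ X` (2.7)."
"For all positive integers `m,n` we put `Δ(m,n) = Σ_q Ψ(q/Q)/φ(q) Σ*_{χ (mod q)} χ(m) χ̄(n)` (2.9).
… There is nothing special with our choice of arithmetic weight `1/φ(q)`". "The bilinear form (2.1)
becomes `𝒮(𝒜×ℬ) = Σ_m Σ_n a_m b_n F(m,n) Δ(m,n)` (2.10)." "… the contribution of diagonal terms
`𝒮_diag(𝒜×ℬ) = Σ_m a_m b_m F(m,m) Δ(m,m)` (2.11) … `δ(m) = ∏_{p∣m} (1 − 1/p)(1 − 1/p² − 1/p³)^{−1}`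
(2.13) … `Ψ̄ = ∫ Ψ(x) dx` (2.16), `𝔖 = ∏_p (1 − 1/p² − 1/p³)` (2.17)."

> **Proposition 2.1** (p0007:L7–13). For `a_m, b_n` and `F(m,n)` satisfying (2.4), (2.3), we have
> `𝒮_diag(𝒜×ℬ) = Ψ̄ 𝔖 Q Σ_m a_m b_m δ(m) F(m,m) + O(Q^{1/2} (log N)^A)` (2.18).
> **Convention.** The exponent `A` in (2.18) depends on that in the growth conditions (2.4).

> **Theorem 2.2** (p0007:L23–33). For any complex numbers `a_m, b_n` satisfying (2.4) and `F(m,n)`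
> satisfying (2.3) with `N ≤ Q^{1−ε}` we have `𝒮(𝒜×ℬ) = 𝒮_diag(𝒜×ℬ) + O(Q (log Q)^{−C})` (2.19)
> for any `C > 0`, the implied constant depends only on `ε`, `C` and `A` in (2.4).

> **Theorem 2.3** (p0007:L42–62; NOT typed in this file — see "Deliberately not here"). Let
> `𝒜 = (a_m)` be given by (2.5) with any complex numbers `ρ(r)` for `1 ≤ r ≤ X` satisfying
> `|ρ(r)| ≤ τ(r)^A` (2.20) for some constant `A ≥ 0`. Moreover, suppose that the `L`-function (2.6)
> has Euler product of degree `g ≤ 3`, and no character is singular for `𝓛(s)`, i.e.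
> `𝓛(s,χ) = Σ λ(l)χ(l)l^{−s}` (2.21) is entire for all `χ`. Assume similar conditions for `ℬ = (b_n)`.
> Then (2.19) holds if `N ≤ Q^{2−ε}` and `X ≤ Q^{1−ε}` if `g = 1,2` (2.22), `X ≤ Q^{1/2}` if `g = 3`
> (2.23). **Note.** … by an `L`-function we mean one of those whose twists by primitive characters
> satisfy proper functional equation, see Section 5.1 of [IK].

"Actually the case of degree `g = 1` is void in the statement of Theorem 2.3 … In order to cover this
case we make an extra cancellation condition for the factor sequence `ρ(r)`;
`Σ_{r ≤ y} ρ(dr) ≪ τ(d) y (log y)^{−C}`, if `y ≥ 2` (2.24) with any `C ≥ 0`, the implied constant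
depending on `C`." (p0007:L70–79.)

> **Theorem 2.4** (p0007:L85–87). Let `𝒜 = (a_m)`, `ℬ = (b_n)` be sequences given by (2.5)
> satisfying the conditions of Proposition 8.1. Then (2.19) holds if `X ≤ Q^{1−ε}` and
> `N ≤ Q^{2−δ}`.

**The conditions of Proposition 8.1** (§8, p0016:L54–p0017:L2 and p0017:L61–66): "We assume that
these coefficients are of the form (2.5) with `λ(l) = 1`, that is with (2.6) being the zeta function
`ζ(s)`, and that `ρ(r)` satisfy (2.24). Actually the `ρ(r)` in `a_m` and those in `b_n` can be
different, say they are `ρ_A(r)`, `ρ_B(r)` respectively. Assume they are supported in dyadic segments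
`X_A ≤ r ≤ 2X_A`, `X_B ≤ r ≤ 2X_B` respectively, with `1 ≤ X_A, X_B ≤ X ≤ Q^{1−2δ}` (8.7). So far we
have been assuming that the support of `F(m,n)` is in the box (2.2). Now … we assume, in addition to
the former properties, that the support of `F(m,n)` implies `Q^{−δ} ≤ m/n ≤ Q^{δ}`,
`mn ≤ X_A X_B Q^{2−2δ}` (8.8) for some constant `δ > 0` (in our applications any `0 < δ < 1/2` will
be sufficient). Moreover we extend (2.3) to `x^i y^j F^{(ij)}(x,y) ≪ 1` (8.8′) for any `i,j ≥ 0`, the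
implied constant depending on `i,j`." Proposition 8.1 itself: "Suppose `𝒜 = (a_m)` is given by (2.5)
with complex numbers `ρ(r)` supported on `X_A ≤ r ≤ 2X_A`, satisfying (2.20) and (2.24). Moreover
suppose the `L`-function (2.6) is exactly the zeta function `ζ(s)`. Assume similar conditions for
`ℬ = (b_n)`. Let `F(m,n)` be a smooth function supported in the box (2.2) whose partial derivatives
satisfy (8.8′). Finally assume the support of `F(m,n)` implies the restrictions (8.8) with some small
constant `δ > 0`. Then `𝒮⁺(𝒜×ℬ) ≪ Q (log Q)^{−C}` (8.12) with any `C ≥ 0`, the implied constant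
depending on `C`."

"It is obvious what factors `ρ(r)` are in our mind when creating the condition (2.24). Since in
applications the `ρ(r)` come as coefficients in a mollifier of `ζ(s)`, it takes the form
`ρ(r) = μ(r) w(r)` (2.25) where `w(r)` is a smooth function supported on `1 ≤ r ≤ X` with
`|w(r)| ≤ 1`, `r|w′(r)| ≤ 1` (2.26). In this case the cancellation condition (2.24) follows from
(1.1)" [`Σ_{n ≤ X} μ(n) ≪ X exp(−√log X)`] (p0007:L89–98).

## Lean rendering / design choices

* FAMILY. `Σ*_{χ (mod q)} χ(m)χ̄(n)` is the `Finset` sum over `χ : DirichletCharacter ℂ q` with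
  `χ.IsPrimitive` (Mathlib; `Fintype (DirichletCharacter ℂ q)` is Mathlib's instance), `χ̄ = conj ∘ χ`
  (`primitiveCharSum`). The `q`-sum in `Δ(m,n)` is a `finsum` over `q : ℕ` (`familyAverage`): for a
  weight `Ψ` with `tsupport Ψ ⊆ [c₁, c₂]`, `0 < c₁` (`IsFamilyWeight`, the reading of "smooth
  function `Ψ` of compact support in `ℝ⁺`") only `c₁Q ≤ q ≤ c₂Q` contribute, so the `finsum` IS the
  printed finite sum; the term `q = 0` is `0` anyway (`Ψ(0) = 0`, and `x/φ(0) = x/0 = 0` in Lean).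
* `𝒮(𝒜×ℬ)` and `𝒮_diag` are `finsum`s over `m, n : ℕ` (`bilinearForm`, `diagonalForm`): `F` is
  supported in `[1,N]²`, so only `1 ≤ m,n ≤ N` contribute and the sums are the printed finite sums.
  `F : ℝ → ℝ → ℂ` (the paper's test functions are real- or complex-valued smooth weights); "smooth" =
  `ContDiff ℝ ∞` of the uncurried function; `F^{(i,j)} = ∂ₓ^i ∂ᵧ^j F` is `mixedPartial i j F`
  (iterated one-variable derivatives, which for smooth `F` is the mixed partial in either order).
* COEFFICIENTS. (2.4) is `CoeffBound A a` with `τ = ArithmeticFunction.sigma 0` and real exponent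
  `A ≥ 0`. For Theorem 2.4 the coefficients ARE `a_m = m^{−1/2} Σ_{r ∣ m} ρ(r)` (`λ ≡ 1`;
  `zetaMollifierCoeff ρ`), with `ρ` dyadically supported, `|ρ(r)| ≤ τ(r)^A` (2.20) and the
  cancellation condition (2.24) — whose "implied constant depending on `C`" must be uniform over the
  `ρ` considered (the `ρ` of the applications depend on `X`, `Q`), so (2.24) is typed with an explicit
  constant FUNCTION `K : ℝ → ℝ` (`C ↦` the implied constant) and the theorem's implied constant is
  allowed to depend on `K` (`IsMollifierFactor A K X ρ`). Likewise (8.8′) carries an explicit table of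
  constants `c : ℕ → ℕ → ℝ` (`IsLocalizedTestFunction`).
* `O(·)` / "`Q` is a large parameter". Each fact is `∃ c, ∀ Q ≥ 2 (resp. ≥ 1), …, ‖LHS − RHS‖ ≤ c·(rate)`
  with `c` quantified AFTER everything the source lets the implied constant depend on (`Ψ`, `ε`, `C`,
  `A`, `δ`, `K`, the (8.8′)-table) and BEFORE `Q, N, X, X_A, X_B`, the coefficients and `F` — i.e.
  uniformly in the data, as an asymptotic-large-sieve statement must be. Powers with real exponents
  are `Real.rpow` (`Q ^ (1 − ε)`, `(log Q) ^ (−C)`, `m ^ (−1/2)`, `τ(m) ^ A`).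
* Proposition 2.1's "`(log N)^A` with an exponent depending on the `A` of (2.4)" = `∃ A' c, … ≤
  c Q^{1/2} (log N)^{A'}`; it is uniform in `Q ≥ 1`, `N ≥ 2` with no relation between them (its
  printed proof: `Δ(m,m) = δ(m)Δ(1,1) + O(τ(m)Q^{1/2})` (2.12), `Δ(1,1) = Ψ̄𝔖Q + O(Q^{1/2})` (2.15)).
* No instances, no notation, nothing about zeros or `L`-functions is declared; imports Mathlib only.

## Deliberately not here

* **Theorem 2.3** (degree `g = 2, 3`, all twists entire): the source's class "an `L`-function in the
  sense of [IK, §5.1] whose twists by primitive characters satisfy proper functional equations" has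
  no definition in the tree; it is to be typed separately in the special cases the paper itself names
  (§1: "`L(s,f)` or `L(s, sym² f)` where `f` is a Hecke cusp form on `SL₂(ℤ)`") over the tree's
  `Literature.ModularForms` vocabulary. -- TODO(general form): Theorem 2.3 as printed.
* §9 "(9.6)/(9.7)", the adjusted forms for test functions `G(m/n, mn/(r₁r₂q^g))` ("assuming the
  conditions of Theorems 2.2, 2.3, 2.4 adjusted to the context" — not a closed statement), and the
  intermediate decompositions of §§3–8 (`Δ′, Δ″, Δ*, Δ⁺`, Lemmas 3.1–7.x).
* The remark that `ρ = μ·w` satisfies (2.24) "by (1.1)" is recorded in prose only.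

References: [cite: ConreyIwaniecSoundararajan2011ALS, §2 Proposition 2.1, Theorems 2.2–2.4; §8
Proposition 8.1 and (8.7)–(8.8′)].

«The programme SEARCHES and TYPES; no claim about Landau–Siegel zeros, Theorems 1–2 of
arXiv:2211.02515 or a repaired Margin232 until a kernel theorem says so.»
-/

noncomputable section

open scoped Classical ComplexConjugate ContDiff
open Complex Finset Filter MeasureTheory

namespace Literature.NumberTheory.LFunctions

namespace AsymptoticLargeSieve

/-! ### The family of primitive characters of conductor `q ≍ Q` -/

/-- The primitive-character sum `Σ*_{χ (mod q)} χ(m) χ̄(n)` over the primitive Dirichlet characters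
modulo `q` (Mathlib `DirichletCharacter.IsPrimitive`: conductor `= q`).
[cite: ConreyIwaniecSoundararajan2011ALS, §2 (2.1) and (2.9)] -/
def primitiveCharSum (q m n : ℕ) : ℂ :=
  ∑ χ : DirichletCharacter ℂ q with χ.IsPrimitive, χ (m : ZMod q) * conj (χ (n : ZMod q))

/-- The averaging operator over the family: `Δ(m,n) = Σ_q Ψ(q/Q) φ(q)⁻¹ Σ*_{χ (mod q)} χ(m) χ̄(n)`
(2.9). A `finsum` over `q : ℕ`; for `Ψ` compactly supported in `(0, ∞)` only finitely many `q ≍ Q`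
contribute (and the `q = 0` term is `0`), so this is the printed finite sum.
[cite: ConreyIwaniecSoundararajan2011ALS, §2 (2.9)] -/
def familyAverage (Ψ : ℝ → ℝ) (Q : ℝ) (m n : ℕ) : ℂ :=
  ∑ᶠ q : ℕ, ((Ψ ((q : ℝ) / Q) / (Nat.totient q : ℝ) : ℝ) : ℂ) * primitiveCharSum q m n

/-- The bilinear form `𝒮(𝒜×ℬ) = Σ_m Σ_n a_m b_n F(m,n) Δ(m,n)` (2.10) = (2.1). A `finsum` over
`m, n : ℕ`; for `F` supported in the box `[1,N]²` only `1 ≤ m, n ≤ N` contribute.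
[cite: ConreyIwaniecSoundararajan2011ALS, §2 (2.1), (2.10)] -/
def bilinearForm (Ψ : ℝ → ℝ) (Q : ℝ) (a b : ℕ → ℂ) (F : ℝ → ℝ → ℂ) : ℂ :=
  ∑ᶠ (m : ℕ) (n : ℕ), a m * b n * F m n * familyAverage Ψ Q m n

/-- The diagonal part `𝒮_diag(𝒜×ℬ) = Σ_m a_m b_m F(m,m) Δ(m,m)` (2.11).
[cite: ConreyIwaniecSoundararajan2011ALS, §2 (2.11)] -/
def diagonalForm (Ψ : ℝ → ℝ) (Q : ℝ) (a b : ℕ → ℂ) (F : ℝ → ℝ → ℂ) : ℂ :=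
  ∑ᶠ m : ℕ, a m * b m * F m m * familyAverage Ψ Q m m

/-- The local factor `δ(m) = ∏_{p ∣ m} (1 − 1/p)(1 − 1/p² − 1/p³)⁻¹` (2.13).
[cite: ConreyIwaniecSoundararajan2011ALS, §2 (2.13)] -/
def deltaFactor (m : ℕ) : ℝ :=
  ∏ p ∈ m.primeFactors, (1 - 1 / (p : ℝ)) * (1 - 1 / (p : ℝ) ^ 2 - 1 / (p : ℝ) ^ 3)⁻¹

/-- The singular series `𝔖 = ∏_p (1 − 1/p² − 1/p³)` (2.17) (an absolutely convergent product over
the primes). [cite: ConreyIwaniecSoundararajan2011ALS, §2 (2.17)] -/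
def singularSeries : ℝ :=
  ∏' p : Nat.Primes, (1 - 1 / ((p : ℕ) : ℝ) ^ 2 - 1 / ((p : ℕ) : ℝ) ^ 3)

/-- The mass `Ψ̄ = ∫ Ψ(x) dx` of the conductor weight (2.16).
[cite: ConreyIwaniecSoundararajan2011ALS, §2 (2.16)] -/
def weightMass (Ψ : ℝ → ℝ) : ℝ :=
  ∫ x, Ψ x

/-- The main term of the diagonal: `Ψ̄ 𝔖 Q Σ_m a_m b_m δ(m) F(m,m)` (right-hand side of (2.18)).
[cite: ConreyIwaniecSoundararajan2011ALS, Proposition 2.1 (2.18)] -/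
def diagonalMainTerm (Ψ : ℝ → ℝ) (Q : ℝ) (a b : ℕ → ℂ) (F : ℝ → ℝ → ℂ) : ℂ :=
  ((weightMass Ψ * singularSeries * Q : ℝ) : ℂ) *
    ∑ᶠ m : ℕ, a m * b m * ((deltaFactor m : ℝ) : ℂ) * F m m

/-! ### The standing hypotheses of §2 -/

/-- "`Ψ` a smooth function of compact support in `ℝ⁺`, so `q ≍ Q`": `Ψ ∈ C^∞(ℝ)` with
`tsupport Ψ ⊆ [c₁, c₂]` for some `0 < c₁ ≤ c₂`. [cite: ConreyIwaniecSoundararajan2011ALS, §2 (after (2.1))] -/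
def IsFamilyWeight (Ψ : ℝ → ℝ) : Prop :=
  ContDiff ℝ ∞ Ψ ∧ ∃ c₁ c₂ : ℝ, 0 < c₁ ∧ tsupport Ψ ⊆ Set.Icc c₁ c₂

/-- The growth condition (2.4): `|a_m| ≤ m^{−1/2} τ(m)^A` for all `m ≥ 1` (`τ = σ₀`, the number of
divisors; `A ≥ 0` a real exponent). [cite: ConreyIwaniecSoundararajan2011ALS, §2 (2.4)] -/
def CoeffBound (A : ℝ) (a : ℕ → ℂ) : Prop :=
  ∀ m : ℕ, 1 ≤ m →
    ‖a m‖ ≤ (m : ℝ) ^ (-(1 / 2 : ℝ)) * ((ArithmeticFunction.sigma 0 m : ℕ) : ℝ) ^ A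

/-- The mixed partial derivative `F^{(i,j)}(x,y) = ∂ₓ^i ∂ᵧ^j F(x,y)` of a two-variable test function,
as iterated one-variable derivatives (for smooth `F` the order of differentiation is immaterial).
[cite: ConreyIwaniecSoundararajan2011ALS, §2 (2.3)] -/
def mixedPartial (i j : ℕ) (F : ℝ → ℝ → ℂ) (x y : ℝ) : ℂ :=
  iteratedDeriv i (fun u => iteratedDeriv j (F u) y) x

/-- The test-function conditions (2.2)–(2.3): `F` smooth, supported in the square box
`1 ≤ x, y ≤ N`, with `x^i y^j |F^{(i,j)}(x,y)| ≤ 1` for `0 ≤ i, j ≤ 2`.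
[cite: ConreyIwaniecSoundararajan2011ALS, §2 (2.2)–(2.3)] -/
def IsBoxTestFunction (N : ℝ) (F : ℝ → ℝ → ℂ) : Prop :=
  ContDiff ℝ ∞ (Function.uncurry F) ∧
    (∀ x y : ℝ, F x y ≠ 0 → (1 ≤ x ∧ x ≤ N) ∧ (1 ≤ y ∧ y ≤ N)) ∧
      ∀ i j : ℕ, i ≤ 2 → j ≤ 2 → ∀ x y : ℝ,
        ‖((x ^ i * y ^ j : ℝ) : ℂ) * mixedPartial i j F x y‖ ≤ 1

/-- A box test function vanishes off the box: `F(x,y) = 0` whenever `x < 1`.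
[cite: ConreyIwaniecSoundararajan2011ALS, §2 (2.2)] -/
theorem IsBoxTestFunction.apply_eq_zero_of_lt_one {N : ℝ} {F : ℝ → ℝ → ℂ}
    (hF : IsBoxTestFunction N F) {x : ℝ} (hx : x < 1) (y : ℝ) : F x y = 0 := by
  by_contra h
  have h1 := (hF.2.1 x y h).1.1
  linarith

/-! ### Proposition 2.1 and Theorem 2.2 (general coefficients) -/

/-- **Conrey–Iwaniec–Soundararajan, Asymptotic Large Sieve, Proposition 2.1** (the diagonal). For
`a_m, b_n` satisfying (2.4) and `F` satisfying (2.2)–(2.3):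
`𝒮_diag(𝒜×ℬ) = Ψ̄ 𝔖 Q Σ_m a_m b_m δ(m) F(m,m) + O(Q^{1/2} (log N)^{A′})`, where the exponent `A′`
depends on the `A` of (2.4) ("Convention" after (2.18)) and the implied constant on `Ψ` and `A`;
uniform in `Q ≥ 1`, `N ≥ 2`, the coefficients and `F`. Status: preprint claim, unrefereed
[claim: ConreyIwaniecSoundararajan2011ALS, status: under-review] (named fact, not proved here). [cite: ConreyIwaniecSoundararajan2011ALS, Proposition 2.1 (2.18)] -/
def conreyIwaniecSoundararajanALS_proposition21 : Prop :=
  ∀ Ψ : ℝ → ℝ, IsFamilyWeight Ψ → ∀ A : ℝ, 0 ≤ A →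
    ∃ A' c : ℝ, ∀ Q N : ℝ, 1 ≤ Q → 2 ≤ N →
      ∀ a b : ℕ → ℂ, CoeffBound A a → CoeffBound A b →
        ∀ F : ℝ → ℝ → ℂ, IsBoxTestFunction N F →
          ‖diagonalForm Ψ Q a b F - diagonalMainTerm Ψ Q a b F‖ ≤
            c * Q ^ (1 / 2 : ℝ) * Real.log N ^ A'

/-- **Conrey–Iwaniec–Soundararajan, Asymptotic Large Sieve, Theorem 2.2** (general coefficients,
short range). For any complex `a_m, b_n` satisfying (2.4) and `F` satisfying (2.2)–(2.3) with
`N ≤ Q^{1−ε}`: `𝒮(𝒜×ℬ) = 𝒮_diag(𝒜×ℬ) + O(Q (log Q)^{−C})` (2.19) for any `C > 0`, the implied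
constant depending only on `ε`, `C`, `A` (and the fixed weight `Ψ`); typed uniformly in `Q ≥ 2`,
`2 ≤ N ≤ Q^{1−ε}`, the coefficients and `F`. Status: preprint claim, unrefereed
[claim: ConreyIwaniecSoundararajan2011ALS, status: under-review] (named fact).
[cite: ConreyIwaniecSoundararajan2011ALS, Theorem 2.2 (2.19)] -/
def conreyIwaniecSoundararajanALS_theorem22 : Prop :=
  ∀ Ψ : ℝ → ℝ, IsFamilyWeight Ψ →
    ∀ ε C A : ℝ, 0 < ε → 0 < C → 0 ≤ A →
      ∃ c : ℝ, ∀ Q N : ℝ, 2 ≤ Q → 2 ≤ N → N ≤ Q ^ (1 - ε) →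
        ∀ a b : ℕ → ℂ, CoeffBound A a → CoeffBound A b →
          ∀ F : ℝ → ℝ → ℂ, IsBoxTestFunction N F →
            ‖bilinearForm Ψ Q a b F - diagonalForm Ψ Q a b F‖ ≤ c * Q * Real.log Q ^ (-C)

/-! ### Theorem 2.4 (mollifier coefficients for `ζ`, long range `N ≤ Q^{2−δ}`) -/

/-- The `ζ`-case coefficients (2.5) with `λ(l) = 1`: `a_m = m^{−1/2} Σ_{lr = m} ρ(r) = m^{−1/2}
Σ_{r ∣ m} ρ(r)` (`a_0 = 0`). [cite: ConreyIwaniecSoundararajan2011ALS, §2 (2.5)–(2.6) with λ ≡ 1,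
§8 (8.2)] -/
def zetaMollifierCoeff (ρ : ℕ → ℂ) (m : ℕ) : ℂ :=
  (((m : ℝ) ^ (-(1 / 2 : ℝ)) : ℝ) : ℂ) * ∑ r ∈ m.divisors, ρ r

/-- `a_0 = 0` for the `ζ`-case coefficients (no divisors of `0` are summed).
[cite: ConreyIwaniecSoundararajan2011ALS, §2 (2.5)] -/
theorem zetaMollifierCoeff_zero (ρ : ℕ → ℂ) : zetaMollifierCoeff ρ 0 = 0 := by
  simp [zetaMollifierCoeff]

/-- The mollifier-factor conditions of Proposition 8.1 / Theorem 2.4 on `ρ`, at dyadic scale `X₀`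
with growth exponent `A` and cancellation constants `K`: (i) `ρ` is supported on the dyadic segment
`X₀ ≤ r ≤ 2X₀`; (ii) `|ρ(r)| ≤ τ(r)^A` (2.20); (iii) the cancellation condition (2.24)
`|Σ_{r ≤ y} ρ(dr)| ≤ K(C) · τ(d) · y (log y)^{−C}` for every `C ≥ 0`, `d ≥ 1`, `y ≥ 2` — the
source's "implied constant depending on `C`" made explicit as the function `K`, so that the
condition is uniform over the family of `ρ` it is applied to.
[cite: ConreyIwaniecSoundararajan2011ALS, §2 (2.20), (2.24); §8 Proposition 8.1] -/
def IsMollifierFactor (A : ℝ) (K : ℝ → ℝ) (X₀ : ℝ) (ρ : ℕ → ℂ) : Prop :=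
  (∀ r : ℕ, ρ r ≠ 0 → X₀ ≤ (r : ℝ) ∧ (r : ℝ) ≤ 2 * X₀) ∧
    (∀ r : ℕ, ‖ρ r‖ ≤ ((ArithmeticFunction.sigma 0 r : ℕ) : ℝ) ^ A) ∧
      ∀ C : ℝ, 0 ≤ C → ∀ d : ℕ, 1 ≤ d → ∀ y : ℝ, 2 ≤ y →
        ‖∑ r ∈ Finset.Icc 1 ⌊y⌋₊, ρ (d * r)‖ ≤
          K C * ((ArithmeticFunction.sigma 0 d : ℕ) : ℝ) * y * Real.log y ^ (-C)

/-- The localized test-function conditions of Proposition 8.1 / Theorem 2.4, at parameters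
`N, Q, δ`, product scale `P = X_A X_B` and derivative-constant table `c`: `F` smooth, supported in the
box `1 ≤ x, y ≤ N` (2.2), its support implying `Q^{−δ} ≤ x/y ≤ Q^{δ}` and `xy ≤ P·Q^{2−2δ}` (8.8),
and `|x^i y^j F^{(i,j)}(x,y)| ≤ c(i,j)` for all `i, j ≥ 0` (8.8′, "the implied constant depending on
`i, j`" made explicit as the table `c`). [cite: ConreyIwaniecSoundararajan2011ALS, §8 (8.8), (8.8′),
Proposition 8.1] -/
def IsLocalizedTestFunction (N Q δ P : ℝ) (c : ℕ → ℕ → ℝ) (F : ℝ → ℝ → ℂ) : Prop :=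
  ContDiff ℝ ∞ (Function.uncurry F) ∧
    (∀ x y : ℝ, F x y ≠ 0 →
      (1 ≤ x ∧ x ≤ N) ∧ (1 ≤ y ∧ y ≤ N) ∧
        (Q ^ (-δ) ≤ x / y ∧ x / y ≤ Q ^ δ) ∧ x * y ≤ P * Q ^ (2 - 2 * δ)) ∧
      ∀ i j : ℕ, ∀ x y : ℝ, ‖((x ^ i * y ^ j : ℝ) : ℂ) * mixedPartial i j F x y‖ ≤ c i j

/-- **Conrey–Iwaniec–Soundararajan, Asymptotic Large Sieve, Theorem 2.4** (with the conditions of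
Proposition 8.1 it refers to, spelled out). Let `a_m = m^{−1/2} Σ_{r∣m} ρ_A(r)`,
`b_n = n^{−1/2} Σ_{r∣n} ρ_B(r)` (the case `𝓛 = ζ` of (2.5)), where `ρ_A`, `ρ_B` are supported on
dyadic segments `[X_A, 2X_A]`, `[X_B, 2X_B]` with `1 ≤ X_A, X_B ≤ X ≤ Q^{1−2δ}` (8.7), satisfy
`|ρ(r)| ≤ τ(r)^A` (2.20) and the cancellation condition (2.24) (constants `K`); let `F` be smooth,
supported in `[1,N]²`, with all-order bounds (8.8′) (constants `c`) and support implying (8.8). Then,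
if `X ≤ Q^{1−ε}` and `N ≤ Q^{2−δ}`, `𝒮(𝒜×ℬ) = 𝒮_diag(𝒜×ℬ) + O(Q (log Q)^{−C})` for any `C ≥ 0`,
the implied constant depending on `Ψ, A, δ, ε, C, K, c` only. Status: preprint claim, unrefereed
[claim: ConreyIwaniecSoundararajan2011ALS, status: under-review] (named fact). This is the printed input allowing mollifiers of length `X = Q^{θ}`, `θ < 1`, against
polynomials of total length `< Q²` on average over conductors `q ≍ Q` (the "`θ < 1` / support `< 2`"
edge). [cite: ConreyIwaniecSoundararajan2011ALS, Theorem 2.4; §8 Proposition 8.1, (8.7)–(8.8′)] -/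
def conreyIwaniecSoundararajanALS_theorem24 : Prop :=
  ∀ Ψ : ℝ → ℝ, IsFamilyWeight Ψ →
    ∀ A δ ε C : ℝ, 0 ≤ A → 0 < δ → 0 < ε → 0 ≤ C →
      ∀ K : ℝ → ℝ, ∀ c : ℕ → ℕ → ℝ,
        ∃ c₀ : ℝ, ∀ Q N X XA XB : ℝ, 2 ≤ Q → 2 ≤ N → N ≤ Q ^ (2 - δ) →
          1 ≤ XA → XA ≤ X → 1 ≤ XB → XB ≤ X → X ≤ Q ^ (1 - ε) → X ≤ Q ^ (1 - 2 * δ) →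
            ∀ ρA ρB : ℕ → ℂ, IsMollifierFactor A K XA ρA → IsMollifierFactor A K XB ρB →
              ∀ F : ℝ → ℝ → ℂ, IsLocalizedTestFunction N Q δ (XA * XB) c F →
                ‖bilinearForm Ψ Q (zetaMollifierCoeff ρA) (zetaMollifierCoeff ρB) F -
                    diagonalForm Ψ Q (zetaMollifierCoeff ρA) (zetaMollifierCoeff ρB) F‖ ≤
                  c₀ * Q * Real.log Q ^ (-C)

/-! ### Bookkeeping (proved) -/

/-- `δ(1) = 1` (empty product). [cite: ConreyIwaniecSoundararajan2011ALS, §2 (2.13)] -/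
theorem deltaFactor_one : deltaFactor 1 = 1 := by
  simp [deltaFactor]

/-- A localized test function (Proposition 8.1 / Theorem 2.4) with a table `c` bounded by `1` on
`i, j ≤ 2` is a box test function in the sense of (2.2)–(2.3) — the §8 conditions "extend" the §2
ones. [cite: ConreyIwaniecSoundararajan2011ALS, §8 (8.8′) vs §2 (2.3)] -/
theorem IsLocalizedTestFunction.isBoxTestFunction {N Q δ P : ℝ} {c : ℕ → ℕ → ℝ}
    {F : ℝ → ℝ → ℂ} (hF : IsLocalizedTestFunction N Q δ P c F)
    (hc : ∀ i j : ℕ, i ≤ 2 → j ≤ 2 → c i j ≤ 1) : IsBoxTestFunction N F := by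
  refine ⟨hF.1, fun x y h => ⟨(hF.2.1 x y h).1, (hF.2.1 x y h).2.1⟩, ?_⟩
  intro i j hi hj x y
  exact (hF.2.2 i j x y).trans (hc i j hi hj)

/-- The range of Theorem 2.4 contains that of Theorem 2.2: `Q^{1−ε} ≤ Q^{2−δ}` once `Q ≥ 1` and
`δ ≤ 1 + ε` (in particular for the printed `0 < δ < 1/2`). [cite: ConreyIwaniecSoundararajan2011ALS,
Theorems 2.2 and 2.4 (ranges N ≤ Q^{1−ε} vs N ≤ Q^{2−δ})] -/
theorem rpow_one_sub_le_rpow_two_sub {Q ε δ : ℝ} (hQ : 1 ≤ Q) (h : δ ≤ 1 + ε) :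
    Q ^ (1 - ε) ≤ Q ^ (2 - δ) := by
  apply Real.rpow_le_rpow_of_exponent_le hQ
  linarith

end AsymptoticLargeSieve

end Literature.NumberTheory.LFunctions

end
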